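import Summits.BirchSwinnertonDyer.BirchSwinnertonDyer.Theorems.AlignedTransportAtTwoMainConjectureOfRankZeroBSDAtTwoFineRoadCoinvDataTight
import HarnessLib

/-!
# Route `AlignedTransportAtTwo`, crux C2 `MainConjectureOfRankZeroBSDAtTwo` (stmt-BirchSwinnertonDyer-22298):
# road (b″) with a `2`-POWER DEFECT in the unit equation, NETTED against the descent kernels

HONEST FRAMING (cell `bsd-f1-sign2`, WIDTH-5 attached prover seat `bsd-line-att-p3` gen 2, line `birth` of the
lead `bsd-line-att-p2`; BSD is NOT proved by any of this). THEOREMS ONLY; nothing asserted. Continuation of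
`…FineRoadCoinvDataTight`. Motivation: the registered stub K₂″ (`stub_katoCoinvDataQiAtTwo`) displays the unit
equation `a + b = s·G₊` with `s ∉ (2)`; the cell's statement audit (REF1-AUDIT §57, 2026-08-28) reads Kato's best
INTEGRAL class at `p = 2` in the tree's currency as `a + b = u·μ_{c,d}·2^{[Δ_E > 0]}·G₊` — a genuine `2` for
`Δ_E > 0` — and asks for the `μ = 0` transfer to be NETTED against an equality-strength archimedean term. This file
is that netting, as kernel algebra:

* §1 `lengthAt_ker_add_le_of_coinvDatum` — the BALANCE-FREE bookkeeping of the road-(b″) data (any prime `p`, any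
  `a, b`, no hypothesis on `X'` or on the balance):
  `ℓ(ker fd) + ℓ(X_D) ≤ ℓ(Λ/(a+b)) + ℓ(ker fy) + ℓ(X_Y)`.
  Both the lead's balance form (`ℓ(ker fy) ≤ ℓ(ker fd)`, file `…CoinvCruxArch`) and the defect form below are
  one cancellation away from it.
* §2 `lengthAt_quotient_span_C_pow_mul_mul` — `ℓ_{(p)}(Λ/(p^e·s·G)) = e + ℓ_{(p)}(Λ/(G))` for `s ∉ (p)`; and the
  per-target DEFECT FORM `lengthAt_eq_zero_of_coinvDatum_defect`: unit equation `a + b = p^e·s·G` with `red G ≠ 0`,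
  `ℓ(X_Y) = 0`, and the DEFECT BALANCE `ℓ(ker fy) + e ≤ ℓ(ker fd)` ⟹ `ℓ(X_D) = 0`.
* §3 at `2`: `selmerDual_mu_eq_zero_of_roadB2_defect_two` (the lead's per-datum theorem with `(e, p^e)` threaded),
  `seedMuZeroAtTwo_of_fineRoadCoinvDefect` / `mainConjectureOfRankZeroBSDAtTwo_of_fineRoadCoinvDefect` (stub T and C2
  BY NAME from the `e`-displayed data K₂ᵉ + Lim + (A₂)); the registered K₂″ is the case `e = 0`. Reading: for `Δ_E > 0` (`e = 1`) road (b″) closes `μ = 0` iff the Selmer-side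
  descent kernel carries ONE MORE unit of `(2)`-length than the fine-side one (`ℓ(ker fd) ≥ ℓ(ker fy) + 1`: the
  `(Λ/2)` of `X^{rel}(E/ℚ_∞) ↠ X^{str}` present on the Selmer side and absent on the fine side) — a precise, sign-
  sensitive target for the typed witness; nothing here asserts it.

References: K. Kato, Astérisque 295 (2004), Thm. 12.5 (4), Thm. 17.4, Prop. 17.11, §17.13; R. Greenberg, LNM 1716
(1999) §3–§4 (real places at `p = 2`); J. Coates, R. Sujatha, Math. Ann. 331 (2005) §3; L. Washington, GTM 83, §13.2.
-/

set_option linter.dupNamespace false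
set_option autoImplicit false

noncomputable section

open scoped Classical

open Literature.NumberTheory.EllipticCurves Literature.NumberTheory.EllipticCurves.Module

namespace Summit.BirchSwinnertonDyer.BirchSwinnertonDyer.Theorems.AlignedTransportAtTwoFineRoad

/-! ## §1 Balance-free bookkeeping -/

section BalanceFree

variable (p : ℕ) [Fact p.Prime]
  {P X' Y' XD XY : Type*} [AddCommGroup P] [_root_.Module (IwasawaAlgebra p) P]
  [AddCommGroup X'] [_root_.Module (IwasawaAlgebra p) X']
  [AddCommGroup Y'] [_root_.Module (IwasawaAlgebra p) Y']
  [AddCommGroup XD] [_root_.Module (IwasawaAlgebra p) XD]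
  [AddCommGroup XY] [_root_.Module (IwasawaAlgebra p) XY]

/-- **BALANCE-FREE BOOKKEEPING of the road-(b″) data.** Over `Λ₀ = ℤ_p⟦T⟧` at `𝔭 = (p)`: a row
`P → X' → Y' → 0` with `Δ`-action, an injective `Δ`-equivariant Coleman map with finite cokernel, `w₁, w₂ ∈ ker toX`
with `col w₁ = (a,b)`, `col w₂ = (b,a)`, a map `fd : X'_Δ → X_D` with finite cokernel and any map `fy : Y'_Δ → X_Y`
give `ℓ(ker fd) + ℓ(X_D) ≤ ℓ(Λ₀/(a+b)) + (ℓ(ker fy) + ℓ(X_Y))` — no hypothesis on `a + b`, on `X'`, or on the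
balance of the two kernels. [cite: Kato2004Asterisque, §12.1, Prop. 17.11, §17.13 (pp. 219–220, 277–280)]
[cite: GreenbergLNM1716, §3–§4] -/
theorem lengthAt_ker_add_le_of_coinvDatum (𝔭 : PrimeSpectrum (IwasawaAlgebra p))
    (h𝔭 : 𝔭.asIdeal = IwasawaAlgebra.augIdealP p)
    (toX : P →ₗ[IwasawaAlgebra p] X') (π : X' →ₗ[IwasawaAlgebra p] Y') (hX : Function.Exact toX π)
    (hπ : Function.Surjective π) (cP : P →ₗ[IwasawaAlgebra p] P) (cX : X' →ₗ[IwasawaAlgebra p] X')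
    (cY : Y' →ₗ[IwasawaAlgebra p] Y') (hcX : toX ∘ₗ cP = cX ∘ₗ toX) (hcY : π ∘ₗ cX = cY ∘ₗ π)
    (col : P →ₗ[IwasawaAlgebra p] IwasawaAlgebra p × IwasawaAlgebra p) (hcol : Function.Injective col)
    (hccol : col ∘ₗ cP = (LinearEquiv.prodComm (IwasawaAlgebra p) (IwasawaAlgebra p) (IwasawaAlgebra p) :
      IwasawaAlgebra p × IwasawaAlgebra p →ₗ[IwasawaAlgebra p] IwasawaAlgebra p × IwasawaAlgebra p) ∘ₗ col)
    (hfin : Finite ((IwasawaAlgebra p × IwasawaAlgebra p) ⧸ LinearMap.range col))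
    {w₁ w₂ : P} (h₁ : toX w₁ = 0) (h₂ : toX w₂ = 0) {a b : IwasawaAlgebra p} (hw₁ : col w₁ = (a, b))
    (hw₂ : col w₂ = (b, a))
    (fd : (X' ⧸ LinearMap.range (cX - 1)) →ₗ[IwasawaAlgebra p] XD) (hfd : Finite (XD ⧸ LinearMap.range fd))
    (fy : (Y' ⧸ LinearMap.range (cY - 1)) →ₗ[IwasawaAlgebra p] XY) :
    lengthAt (IwasawaAlgebra p) (LinearMap.ker fd) 𝔭 + lengthAt (IwasawaAlgebra p) XD 𝔭 ≤
      lengthAt (IwasawaAlgebra p) (IwasawaAlgebra p ⧸ Ideal.span {a + b}) 𝔭 +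
        (lengthAt (IwasawaAlgebra p) (LinearMap.ker fy) 𝔭 + lengthAt (IwasawaAlgebra p) XY 𝔭) := by
  haveI := hfin
  haveI := hfd
  have hc : lengthAt (IwasawaAlgebra p) ((IwasawaAlgebra p × IwasawaAlgebra p) ⧸ LinearMap.range col) 𝔭 = 0 :=
    lengthAt_augIdealP_eq_zero_of_finite p _ 𝔭 h𝔭
  have h1 := lengthAt_coinv_le_of_roadB2 toX π hX hπ cP cX cY hcX hcY col hcol hccol h₁ h₂ hw₁ hw₂ 𝔭
  rw [hc, zero_add] at h1
  have h2 := lengthAt_le_ker_add fy 𝔭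
  have h3 : lengthAt (IwasawaAlgebra p) (X' ⧸ LinearMap.range (cX - 1)) 𝔭 =
      lengthAt (IwasawaAlgebra p) (LinearMap.ker fd) 𝔭 + lengthAt (IwasawaAlgebra p) (LinearMap.range fd) 𝔭 := by
    rw [lengthAt_eq_add_quotient (LinearMap.ker fd) 𝔭, lengthAt_eq_of_linearEquiv fd.quotKerEquivRange 𝔭]
  have h4 : lengthAt (IwasawaAlgebra p) XD 𝔭 = lengthAt (IwasawaAlgebra p) (LinearMap.range fd) 𝔭 := by
    rw [lengthAt_eq_add_quotient (LinearMap.range fd) 𝔭,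
      lengthAt_augIdealP_eq_zero_of_finite p (XD ⧸ LinearMap.range fd) 𝔭 h𝔭, add_zero]
  calc lengthAt (IwasawaAlgebra p) (LinearMap.ker fd) 𝔭 + lengthAt (IwasawaAlgebra p) XD 𝔭
      = lengthAt (IwasawaAlgebra p) (X' ⧸ LinearMap.range (cX - 1)) 𝔭 := by rw [h4, ← h3]
    _ ≤ lengthAt (IwasawaAlgebra p) (IwasawaAlgebra p ⧸ Ideal.span {a + b}) 𝔭 +
          lengthAt (IwasawaAlgebra p) (Y' ⧸ LinearMap.range (cY - 1)) 𝔭 := h1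
    _ ≤ lengthAt (IwasawaAlgebra p) (IwasawaAlgebra p ⧸ Ideal.span {a + b}) 𝔭 +
          (lengthAt (IwasawaAlgebra p) (LinearMap.ker fy) 𝔭 + lengthAt (IwasawaAlgebra p) XY 𝔭) := by
        gcongr

end BalanceFree

/-! ## §2 The unit equation with a `p`-power defect -/

section Defect

open Summit.BirchSwinnertonDyer.Rank1Residual.X1.MuLambda

variable (p : ℕ) [Fact p.Prime]

/-- `ℓ_{(p)}(Λ/(p^e·s·G)) = e + ℓ_{(p)}(Λ/(G))` for `s ∉ (p)`. [folklore] -/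
theorem lengthAt_quotient_span_C_pow_mul_mul (e : ℕ) {s : IwasawaAlgebra p}
    (hs : s ∉ IwasawaAlgebra.augIdealP p) (G : IwasawaAlgebra p) (𝔭 : PrimeSpectrum (IwasawaAlgebra p))
    (h𝔭 : 𝔭.asIdeal = IwasawaAlgebra.augIdealP p) :
    lengthAt (IwasawaAlgebra p) (IwasawaAlgebra p ⧸ Ideal.span {PowerSeries.C ((p : ℤ_[p]) ^ e) * s * G}) 𝔭 =
      e + lengthAt (IwasawaAlgebra p) (IwasawaAlgebra p ⧸ Ideal.span {G}) 𝔭 := by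
  have h0 : (PowerSeries.C ((p : ℤ_[p]) ^ e) * s : IwasawaAlgebra p) ≠ 0 :=
    mul_ne_zero (C_pow_ne_zero e) (ne_zero_of_not_mem_augIdealP hs)
  have hs' : ¬ (PowerSeries.C (p : ℤ_[p]) : IwasawaAlgebra p) ∣ s := fun h =>
    hs (by rw [IwasawaAlgebra.augIdealP, Ideal.mem_span_singleton]; exact h)
  rw [lengthAt_quotient_span_singleton_mul G h0 𝔭, map_pow,
    lengthAt_quotient_span_singleton_pow_mul (IwasawaAlgebra.prime_C p) e hs' 𝔭 (by rw [h𝔭]; rfl)]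

variable {P X' Y' XD XY : Type*} [AddCommGroup P] [_root_.Module (IwasawaAlgebra p) P]
  [AddCommGroup X'] [_root_.Module (IwasawaAlgebra p) X']
  [AddCommGroup Y'] [_root_.Module (IwasawaAlgebra p) Y']
  [AddCommGroup XD] [_root_.Module (IwasawaAlgebra p) XD]
  [AddCommGroup XY] [_root_.Module (IwasawaAlgebra p) XY]

/-- **DEFECT FORM, per target pair.** The road-(b″) data with unit equation `a + b = p^e·s·G` (`s ∉ (p)`,
`red G ≠ 0` — a `p`-power defect `e` in the zeta value, as at `p = 2`, `Δ_E > 0`), `X'` finitely generated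
torsion, `ℓ_{(p)}(X_Y) = 0` (statement (A)) and the DEFECT BALANCE `ℓ(ker fy) + e ≤ ℓ(ker fd)` give
`ℓ_{(p)}(X_D) = 0`. For `e = 0` this is the lead's `selmerDual_mu_eq_zero_of_roadB2_arch_two` (abstract form).
[cite: Kato2004Asterisque, Thm. 12.5 (4) and §17.13 (pp. 227, 279–280)] [cite: GreenbergLNM1716, §3–§4]
[cite: CoatesSujatha2005, statement (A) (§3)] -/
theorem lengthAt_eq_zero_of_coinvDatum_defect (𝔭 : PrimeSpectrum (IwasawaAlgebra p))
    (h𝔭 : 𝔭.asIdeal = IwasawaAlgebra.augIdealP p)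
    (toX : P →ₗ[IwasawaAlgebra p] X') (π : X' →ₗ[IwasawaAlgebra p] Y') (hX : Function.Exact toX π)
    (hπ : Function.Surjective π) (cP : P →ₗ[IwasawaAlgebra p] P) (cX : X' →ₗ[IwasawaAlgebra p] X')
    (cY : Y' →ₗ[IwasawaAlgebra p] Y') (hcX : toX ∘ₗ cP = cX ∘ₗ toX) (hcY : π ∘ₗ cX = cY ∘ₗ π)
    (col : P →ₗ[IwasawaAlgebra p] IwasawaAlgebra p × IwasawaAlgebra p) (hcol : Function.Injective col)
    (hccol : col ∘ₗ cP = (LinearEquiv.prodComm (IwasawaAlgebra p) (IwasawaAlgebra p) (IwasawaAlgebra p) :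
      IwasawaAlgebra p × IwasawaAlgebra p →ₗ[IwasawaAlgebra p] IwasawaAlgebra p × IwasawaAlgebra p) ∘ₗ col)
    (hfin : Finite ((IwasawaAlgebra p × IwasawaAlgebra p) ⧸ LinearMap.range col))
    {w₁ w₂ : P} (h₁ : toX w₁ = 0) (h₂ : toX w₂ = 0) {a b s G : IwasawaAlgebra p} {e : ℕ}
    (hw₁ : col w₁ = (a, b)) (hw₂ : col w₂ = (b, a)) (hs : s ∉ IwasawaAlgebra.augIdealP p) (hG : red G ≠ 0)
    (hab : a + b = PowerSeries.C ((p : ℤ_[p]) ^ e) * s * G)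
    (hXfg : Module.Finite (IwasawaAlgebra p) X') (hXt : Module.IsTorsion (IwasawaAlgebra p) X')
    (fd : (X' ⧸ LinearMap.range (cX - 1)) →ₗ[IwasawaAlgebra p] XD) (hfd : Finite (XD ⧸ LinearMap.range fd))
    (fy : (Y' ⧸ LinearMap.range (cY - 1)) →ₗ[IwasawaAlgebra p] XY) (hY : lengthAt (IwasawaAlgebra p) XY 𝔭 = 0)
    (hdef : lengthAt (IwasawaAlgebra p) (LinearMap.ker fy) 𝔭 + e ≤
      lengthAt (IwasawaAlgebra p) (LinearMap.ker fd) 𝔭) :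
    lengthAt (IwasawaAlgebra p) XD 𝔭 = 0 := by
  haveI := hXfg
  have h := lengthAt_ker_add_le_of_coinvDatum p 𝔭 h𝔭 toX π hX hπ cP cX cY hcX hcY col hcol hccol hfin h₁ h₂
    hw₁ hw₂ fd hfd fy
  have hq : lengthAt (IwasawaAlgebra p) (IwasawaAlgebra p ⧸ Ideal.span {G}) 𝔭 = 0 :=
    lengthAt_quotient_eq_zero_of_not_le
      (by rw [Ideal.span_singleton_le_iff_mem, h𝔭]; exact not_mem_augIdealP_of_red_ne_zero hG)
  rw [hab, lengthAt_quotient_span_C_pow_mul_mul p e hs G 𝔭 h𝔭, hq, hY, add_zero, add_zero] at h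
  have hker_ne : lengthAt (IwasawaAlgebra p) (LinearMap.ker fd) 𝔭 ≠ ⊤ :=
    ne_top_of_le_ne_top
      (ne_top_of_le_ne_top (lengthAt_ne_top_of_isTorsion p X' hXt 𝔭 h𝔭) (lengthAt_quotient_le _ 𝔭))
      (lengthAt_submodule_le _ 𝔭)
  have h' : lengthAt (IwasawaAlgebra p) (LinearMap.ker fd) 𝔭 + lengthAt (IwasawaAlgebra p) XD 𝔭 ≤
      lengthAt (IwasawaAlgebra p) (LinearMap.ker fd) 𝔭 + 0 := by
    rw [add_zero]
    exact h.trans (by rw [add_comm]; exact hdef)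
  exact nonpos_iff_eq_zero.mp ((ENat.add_le_add_iff_left hker_ne).mp h')

end Defect

/-! ## §3 At `2`: the defect road to stub T and to the crux -/

section AtTwo

open WeierstrassCurve Summit.BirchSwinnertonDyer.Rank1Residual.X1.MuLambda

variable (W : WeierstrassCurve ℚ) {κ : ZpExtension ℚ 2} {γ : Field.absoluteGaloisGroup ℚ}

/-- **ROAD (b″) PER CYCLOTOMIC DATUM WITH A `2`-POWER DEFECT.** As the lead's
`selmerDual_mu_eq_zero_of_roadB2_arch_two`, with the unit equation `a + b = 2^e·s·G₊` (`s ∉ (2)`; `e = [Δ_E > 0]`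
in the reading of REF1-AUDIT §57) and the balance replaced by the DEFECT BALANCE `ℓ(ker fy) + e ≤ ℓ(ker fd)`:
statement (A) at `(E,2)` + even-branch `μ₂ = 0` + the displayed data ⟹ `μ(X(E/ℚ_∞)) = 0`.
[cite: Kato2004Asterisque, Thm. 17.4 (1) (p. 273), Prop. 17.11 (p. 277), §17.13 (pp. 279–280)]
[cite: GreenbergLNM1716, §3–§4] [cite: CoatesSujatha2005, statement (A) (§3)] -/
theorem selmerDual_mu_eq_zero_of_roadB2_defect_two (hγ : κ.IsTopGenerator γ) (D : W.SelmerDualData κ γ)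
    (Yd : W.FineSelmerDualData κ γ) (hA : Set.Finite {s : W.fineSelmerInfty κ | 2 • s = 0})
    {G : IwasawaAlgebra 2} (hred : red G ≠ 0)
    {P X' Y' : Type*} [AddCommGroup P] [_root_.Module (IwasawaAlgebra 2) P]
    [AddCommGroup X'] [_root_.Module (IwasawaAlgebra 2) X']
    [AddCommGroup Y'] [_root_.Module (IwasawaAlgebra 2) Y']
    (toX : P →ₗ[IwasawaAlgebra 2] X') (π : X' →ₗ[IwasawaAlgebra 2] Y') (hX : Function.Exact toX π)
    (hπ : Function.Surjective π) (cP : P →ₗ[IwasawaAlgebra 2] P) (cX : X' →ₗ[IwasawaAlgebra 2] X')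
    (cY : Y' →ₗ[IwasawaAlgebra 2] Y') (hcX : toX ∘ₗ cP = cX ∘ₗ toX) (hcY : π ∘ₗ cX = cY ∘ₗ π)
    (col : P →ₗ[IwasawaAlgebra 2] IwasawaAlgebra 2 × IwasawaAlgebra 2) (hcol : Function.Injective col)
    (hccol : col ∘ₗ cP = (LinearEquiv.prodComm (IwasawaAlgebra 2) (IwasawaAlgebra 2) (IwasawaAlgebra 2) :
      IwasawaAlgebra 2 × IwasawaAlgebra 2 →ₗ[IwasawaAlgebra 2] IwasawaAlgebra 2 × IwasawaAlgebra 2) ∘ₗ col)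
    (hfin : Finite ((IwasawaAlgebra 2 × IwasawaAlgebra 2) ⧸ LinearMap.range col))
    {w₁ w₂ : P} (h₁ : toX w₁ = 0) (h₂ : toX w₂ = 0) {a b s : IwasawaAlgebra 2} {e : ℕ} (hw₁ : col w₁ = (a, b))
    (hw₂ : col w₂ = (b, a)) (hs : s ∉ IwasawaAlgebra.augIdealP 2)
    (hab : a + b = PowerSeries.C ((2 : ℤ_[2]) ^ e) * s * G)
    (hXfg : Module.Finite (IwasawaAlgebra 2) X') (hXt : Module.IsTorsion (IwasawaAlgebra 2) X')
    (fd : (X' ⧸ LinearMap.range (cX - 1)) →ₗ[IwasawaAlgebra 2] D.X)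
    (hfd : Finite (D.X ⧸ LinearMap.range fd))
    (fy : (Y' ⧸ LinearMap.range (cY - 1)) →ₗ[IwasawaAlgebra 2] Yd.X)
    (hdef : lengthAt (IwasawaAlgebra 2) (LinearMap.ker fy)
        ⟨IwasawaAlgebra.augIdealP 2, IwasawaAlgebra.isPrime_augIdealP_holds 2⟩ + e ≤
      lengthAt (IwasawaAlgebra 2) (LinearMap.ker fd)
        ⟨IwasawaAlgebra.augIdealP 2, IwasawaAlgebra.isPrime_augIdealP_holds 2⟩) : D.mu = 0 := by
  let 𝔭 : PrimeSpectrum (IwasawaAlgebra 2) :=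
    ⟨IwasawaAlgebra.augIdealP 2, IwasawaAlgebra.isPrime_augIdealP_holds 2⟩
  have hYd : lengthAt (IwasawaAlgebra 2) Yd.X 𝔭 = 0 :=
    lengthAt_fineSelmerDual_eq_zero_of_finite_twoTorsion W hγ Yd hA
  have hX0 : lengthAt (IwasawaAlgebra 2) D.X 𝔭 = 0 :=
    lengthAt_eq_zero_of_coinvDatum_defect 2 𝔭 rfl toX π hX hπ cP cX cY hcX hcY col hcol hccol hfin h₁ h₂ hw₁
      hw₂ hs hred (by exact_mod_cast hab) hXfg hXt fd hfd fy hYd hdef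
  change muInvariant 2 D.X = 0
  rw [muInvariant_eq_toNat_lengthAt 2 D.X 𝔭 rfl, hX0]
  rfl

end AtTwo

section Crux

open CongruenceSubgroup WeierstrassCurve Literature.NumberTheory.EllipticCurves.ModularForms
  Literature.NumberTheory.EllipticCurves.Greenberg1999
  Literature.NumberTheory.EllipticCurves.Rank1Residual
  Literature.NumberTheory.IwasawaTheory
  Summit.BirchSwinnertonDyer.Rank1Residual Summit.BirchSwinnertonDyer.Rank1Residual.X1.MuLambda
  Summit.BirchSwinnertonDyer.Rank1Residual.X5 Summit.BirchSwinnertonDyer.Rank1Residual.F1Sign2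
  Summit.BirchSwinnertonDyer.BirchSwinnertonDyer.Theorems.Rank1ResidualX1Defs
  Summit.BirchSwinnertonDyer.BirchSwinnertonDyer.Theses.AlignedTransportAtTwo

/-- **Stub T of line `birth` on road (b″) with a DISPLAYED `2`-POWER DEFECT (K₂ᵉ).** Modularity + Lim 2017 at `2`
+ for every seed-cell curve and datum the road-(b″) data with unit equation `a + b = 2^e·s·G₊` for SOME `e` and
the defect balance `ℓ(ker fy) + e ≤ ℓ(ker fd)` (DISPLAYED: Kato's row over `ℚ(ζ_{2^∞})`, Prop. 17.11, the integral
`(c,d)`-class with its `2`-power, the two descents; nothing asserted) + (A₂) ⟹ `SeedMuZeroAtTwo`.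
[cite: Kato2004Asterisque, Thm. 17.4 (1), Prop. 17.11, §17.13 (pp. 273–280)] [cite: Lim2017FineSelmer, §3 Thm. 3.5 and Lemma 3.2]
[cite: GreenbergLNM1716, §3–§4] -/
theorem seedMuZeroAtTwo_of_fineRoadCoinvDefect (hmod : nonempty_modularParametrizationData)
    (hLim : Lim2017.thm35_at_two_fineSelmerDual_moduleFinite_of_classicalMuVanishes_of_le_divisionField_four)
    (hK2e : ∀ (W : WeierstrassCurve ℚ) [W.IsElliptic] [W.IsGloballyMinimal], IsOrdinaryAt W 2 →
      (∀ x : ℚ, ¬ HasRationalTwoTorsionX W x) →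
      ∀ (κ : ZpExtension ℚ 2) (γ : Field.absoluteGaloisGroup ℚ), κ.IsCyclotomic →
      κ.IsTopGenerator γ → IsCyclotomicVariable 2 γ →
      ∀ ⦃N : ℕ⦄ [NeZero N] (f : CuspForm (Gamma0 N) 2), IsNewformOf W f →
      ∀ Gp : IwasawaAlgebra 2, iwasawaToPowerSeries 2 Gp = padicLFunction f (unitRoot W 2 : ℚ_[2]) →
      ∀ (D : W.SelmerDualData κ γ) (Yd : W.FineSelmerDualData κ γ),
        ∃ (P X' Y' : Type) (_ : AddCommGroup P) (_ : _root_.Module (IwasawaAlgebra 2) P)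
          (_ : AddCommGroup X') (_ : _root_.Module (IwasawaAlgebra 2) X')
          (_ : AddCommGroup Y') (_ : _root_.Module (IwasawaAlgebra 2) Y')
          (toX : P →ₗ[IwasawaAlgebra 2] X') (π : X' →ₗ[IwasawaAlgebra 2] Y')
          (cP : P →ₗ[IwasawaAlgebra 2] P) (cX : X' →ₗ[IwasawaAlgebra 2] X')
          (cY : Y' →ₗ[IwasawaAlgebra 2] Y')
          (col : P →ₗ[IwasawaAlgebra 2] IwasawaAlgebra 2 × IwasawaAlgebra 2) (w₁ w₂ : P)
          (a b s : IwasawaAlgebra 2) (e : ℕ) (fd : (X' ⧸ LinearMap.range (cX - 1)) →ₗ[IwasawaAlgebra 2] D.X)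
          (fy : (Y' ⧸ LinearMap.range (cY - 1)) →ₗ[IwasawaAlgebra 2] Yd.X),
          Function.Exact toX π ∧ Function.Surjective π ∧ toX ∘ₗ cP = cX ∘ₗ toX ∧ π ∘ₗ cX = cY ∘ₗ π ∧
          Function.Injective col ∧
          col ∘ₗ cP = (LinearEquiv.prodComm (IwasawaAlgebra 2) (IwasawaAlgebra 2) (IwasawaAlgebra 2) :
            IwasawaAlgebra 2 × IwasawaAlgebra 2 →ₗ[IwasawaAlgebra 2]
              IwasawaAlgebra 2 × IwasawaAlgebra 2) ∘ₗ col ∧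
          Finite ((IwasawaAlgebra 2 × IwasawaAlgebra 2) ⧸ LinearMap.range col) ∧
          toX w₁ = 0 ∧ toX w₂ = 0 ∧ col w₁ = (a, b) ∧ col w₂ = (b, a) ∧
          s ∉ IwasawaAlgebra.augIdealP 2 ∧ a + b = PowerSeries.C ((2 : ℤ_[2]) ^ e) * s * Gp ∧
          Module.Finite (IwasawaAlgebra 2) X' ∧ Module.IsTorsion (IwasawaAlgebra 2) X' ∧
          Finite (D.X ⧸ LinearMap.range fd) ∧
          lengthAt (IwasawaAlgebra 2) (LinearMap.ker fy)
              ⟨IwasawaAlgebra.augIdealP 2, IwasawaAlgebra.isPrime_augIdealP_holds 2⟩ + e ≤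
            lengthAt (IwasawaAlgebra 2) (LinearMap.ker fd)
              ⟨IwasawaAlgebra.augIdealP 2, IwasawaAlgebra.isPrime_augIdealP_holds 2⟩)
    (hA2 : ∀ (W : WeierstrassCurve ℚ) [W.IsElliptic] [W.IsGloballyMinimal], ¬ W.HasCM →
      IsOrdinaryAt W 2 → (∀ x : ℚ, ¬ HasRationalTwoTorsionX W x) → ¬ IsSquare W.Δ →
      W.analyticRank = 0 → BSDp W 2 →
      ∃ L : IntermediateField ℚ (AlgebraicClosure ℚ), L ≤ W.divisionField 4 ∧
        (∃ k : ℕ, Module.finrank ℚ (W.divisionField 4) = 2 ^ k * Module.finrank ℚ L) ∧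
        ∀ κL : ZpExtension L 2, κL.IsCyclotomic → ClassicalMuVanishes κL) :
    ∀ (W : WeierstrassCurve ℚ) [W.IsElliptic] [W.IsGloballyMinimal], ¬ W.HasCM →
      IsOrdinaryAt W 2 → (∀ x : ℚ, ¬ HasRationalTwoTorsionX W x) → ¬ IsSquare W.Δ →
      W.analyticRank = 0 →
      (∀ ⦃N : ℕ⦄ [NeZero N] (f : CuspForm (Gamma0 N) 2), IsNewformOf W f →
        ∀ G : IwasawaAlgebra 2, IsEvenBranchLiftAtTwo W f G → red G ≠ 0) →
      BSDp W 2 →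
      ∀ (κ : ZpExtension ℚ 2) (γ : Field.absoluteGaloisGroup ℚ), κ.IsCyclotomic →
        κ.IsTopGenerator γ → IsCyclotomicVariable 2 γ →
        ∀ D : W.SelmerDualData κ γ, D.IsTorsion → D.mu = 0 := by
  intro W _ _ hcm hord ht hsq hr hμan hbsd κ γ hκ hγ hγ' D _
  have hirr : Irr W 2 := AlignedTransportAtTwoSeed.irr_two_of_forall_not_hasRationalTwoTorsionX W ht
  haveI : NeZero (W.conductorNorm ℤ) := ⟨(W.conductorNorm_pos_holds).ne'⟩
  obtain ⟨Dm⟩ := hmod W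
  obtain ⟨Gp, hGp⟩ := exists_iwasawaToPowerSeries_eq_padicLFunction_two hord Dm.isNewformOf hirr
  have hred : red Gp ≠ 0 := hμan Dm.f Dm.isNewformOf Gp (Or.inl ⟨hord, hGp⟩)
  let Yd : W.FineSelmerDualData κ γ := W.fineSelmerDualData κ hγ
  obtain ⟨P, X', Y', _, _, _, _, _, _, toX, π, cP, cX, cY, col, w₁, w₂, a, b, s, e, fd, fy, hX, hπ, hcX, hcY,
    hcol, hccol, hfin, h₁, h₂, hw₁, hw₂, hs, hab, hXfg, hXt, hfd, hdef⟩ :=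
    hK2e W hord ht κ γ hκ hγ hγ' Dm.f Dm.isNewformOf Gp hGp D Yd
  obtain ⟨L, hL, hidx, hμL⟩ := hA2 W hcm hord ht hsq hr hbsd
  have hA := finite_fineSelmer_twoTorsion_of_classicalMu W hLim L hL hidx hμL κ hκ
  exact selmerDual_mu_eq_zero_of_roadB2_defect_two W hγ D Yd hA hred toX π hX hπ cP cX cY hcX hcY col hcol
    hccol hfin h₁ h₂ hw₁ hw₂ hs hab hXfg hXt fd hfd fy hdef

/-- **C2 BY NAME on road (b″) with a displayed `2`-power defect.** PRINT {Kato 17.4 (1)(2) at `2`, Greenberg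
4.1, period unit, modularity, GZK, Lim 2017 Thm. 3.5 at `2`} + (K₂ᵉ) + (A₂) ⟹ `MainConjectureOfRankZeroBSDAtTwo`.
CONDITIONAL: the item stays open. [cite: Kato2004Asterisque, Thm. 17.4 (p. 273) and §17.13 (pp. 279–280)]
[cite: Lim2017FineSelmer, §3 Thm. 3.5 and Lemma 3.2] [cite: GreenbergLNM1716, Thm. 4.1 (p. 102) and Conj. 1.11 (p. 58)] -/
theorem mainConjectureOfRankZeroBSDAtTwo_of_fineRoadCoinvDefect
    (h17 : ∀ (V : WeierstrassCurve ℚ) [V.IsElliptic] [V.IsGloballyMinimal] [NeZero (V.conductorNorm ℤ)]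
      (f : CuspForm (Gamma0 (V.conductorNorm ℤ)) 2), kato_divisibility_allPrimes V 2 (f := f))
    (hGr : Greenberg1999.thm41_charValue_rankZero_anyPrime)
    (hper : realPeriodRat_eq_unit_mul_plusPeriod_two) (hmod : nonempty_modularParametrizationData)
    (hGZK : rank_eq_analyticRank_of_analyticRank_le_one)
    (hLim : Lim2017.thm35_at_two_fineSelmerDual_moduleFinite_of_classicalMuVanishes_of_le_divisionField_four)
    (hK2e : ∀ (W : WeierstrassCurve ℚ) [W.IsElliptic] [W.IsGloballyMinimal], IsOrdinaryAt W 2 →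
      (∀ x : ℚ, ¬ HasRationalTwoTorsionX W x) →
      ∀ (κ : ZpExtension ℚ 2) (γ : Field.absoluteGaloisGroup ℚ), κ.IsCyclotomic →
      κ.IsTopGenerator γ → IsCyclotomicVariable 2 γ →
      ∀ ⦃N : ℕ⦄ [NeZero N] (f : CuspForm (Gamma0 N) 2), IsNewformOf W f →
      ∀ Gp : IwasawaAlgebra 2, iwasawaToPowerSeries 2 Gp = padicLFunction f (unitRoot W 2 : ℚ_[2]) →
      ∀ (D : W.SelmerDualData κ γ) (Yd : W.FineSelmerDualData κ γ),
        ∃ (P X' Y' : Type) (_ : AddCommGroup P) (_ : _root_.Module (IwasawaAlgebra 2) P)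
          (_ : AddCommGroup X') (_ : _root_.Module (IwasawaAlgebra 2) X')
          (_ : AddCommGroup Y') (_ : _root_.Module (IwasawaAlgebra 2) Y')
          (toX : P →ₗ[IwasawaAlgebra 2] X') (π : X' →ₗ[IwasawaAlgebra 2] Y')
          (cP : P →ₗ[IwasawaAlgebra 2] P) (cX : X' →ₗ[IwasawaAlgebra 2] X')
          (cY : Y' →ₗ[IwasawaAlgebra 2] Y')
          (col : P →ₗ[IwasawaAlgebra 2] IwasawaAlgebra 2 × IwasawaAlgebra 2) (w₁ w₂ : P)
          (a b s : IwasawaAlgebra 2) (e : ℕ) (fd : (X' ⧸ LinearMap.range (cX - 1)) →ₗ[IwasawaAlgebra 2] D.X)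
          (fy : (Y' ⧸ LinearMap.range (cY - 1)) →ₗ[IwasawaAlgebra 2] Yd.X),
          Function.Exact toX π ∧ Function.Surjective π ∧ toX ∘ₗ cP = cX ∘ₗ toX ∧ π ∘ₗ cX = cY ∘ₗ π ∧
          Function.Injective col ∧
          col ∘ₗ cP = (LinearEquiv.prodComm (IwasawaAlgebra 2) (IwasawaAlgebra 2) (IwasawaAlgebra 2) :
            IwasawaAlgebra 2 × IwasawaAlgebra 2 →ₗ[IwasawaAlgebra 2]
              IwasawaAlgebra 2 × IwasawaAlgebra 2) ∘ₗ col ∧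
          Finite ((IwasawaAlgebra 2 × IwasawaAlgebra 2) ⧸ LinearMap.range col) ∧
          toX w₁ = 0 ∧ toX w₂ = 0 ∧ col w₁ = (a, b) ∧ col w₂ = (b, a) ∧
          s ∉ IwasawaAlgebra.augIdealP 2 ∧ a + b = PowerSeries.C ((2 : ℤ_[2]) ^ e) * s * Gp ∧
          Module.Finite (IwasawaAlgebra 2) X' ∧ Module.IsTorsion (IwasawaAlgebra 2) X' ∧
          Finite (D.X ⧸ LinearMap.range fd) ∧
          lengthAt (IwasawaAlgebra 2) (LinearMap.ker fy)
              ⟨IwasawaAlgebra.augIdealP 2, IwasawaAlgebra.isPrime_augIdealP_holds 2⟩ + e ≤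
            lengthAt (IwasawaAlgebra 2) (LinearMap.ker fd)
              ⟨IwasawaAlgebra.augIdealP 2, IwasawaAlgebra.isPrime_augIdealP_holds 2⟩)
    (hA2 : ∀ (W : WeierstrassCurve ℚ) [W.IsElliptic] [W.IsGloballyMinimal], ¬ W.HasCM →
      IsOrdinaryAt W 2 → (∀ x : ℚ, ¬ HasRationalTwoTorsionX W x) → ¬ IsSquare W.Δ →
      W.analyticRank = 0 → BSDp W 2 →
      ∃ L : IntermediateField ℚ (AlgebraicClosure ℚ), L ≤ W.divisionField 4 ∧
        (∃ k : ℕ, Module.finrank ℚ (W.divisionField 4) = 2 ^ k * Module.finrank ℚ L) ∧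
        ∀ κL : ZpExtension L 2, κL.IsCyclotomic → ClassicalMuVanishes κL) :
    MainConjectureOfRankZeroBSDAtTwo :=
  AlignedTransportAtTwoSeed.mainConjectureOfRankZeroBSDAtTwo_of_seedMuZero h17 hGr hper hmod hGZK
    (seedMuZeroAtTwo_of_fineRoadCoinvDefect hmod hLim hK2e hA2)

end Crux

end Summit.BirchSwinnertonDyer.BirchSwinnertonDyer.Theorems.AlignedTransportAtTwoFineRoad

end
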